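import Summits.AtomisticToContinuum.FouriersLaw.Theorems.HiddenChargeMazurNoOddChargePolyList

/-!
# No odd small-range charges for the pinned anharmonic chain — the local conservation law

Support file for item `stmt-AtomisticToContinuum-13514` (`HiddenChargeMazur.NoOddChargeSmallRange`):
every momentum-odd polynomial 3-site density of degree `≤ 4` with a local conservation law of the infinite
pinned anharmonic chain is a coboundary `h ∘ shift − h` (this algebraic half), hence has sub-extensive current
overlap (the analytic half).

The summand `consTerm` of the route's local conservation law vanishes off the window and its `tsum` is the
3-term window sum; on flat table densities it is an explicit polynomial (`consTerm_evalList`); for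
`pinnedChain` the force splits into harmonic and anharmonic parts (`pieceH`, `pieceA`); summing the law over the
window positions meeting a configuration supported on sites `0..4` the flux telescopes away
(`sum_shifts_consTerm_eq_zero`); homogeneity under scaling then separates total degrees and gives the four
GRADED identities `graded_zero` (degrees 1–4).
-/

noncomputable section

open scoped BigOperators
open Literature.MathematicalPhysics.KineticTheory.HeatConduction

namespace Summit.AtomisticToContinuum.FouriersLaw.Theorems.NoOddCharge

/-! ## Part B: the odd monomial tables (exponents `(a₋₁,a₀,a₁,b₋₁,b₀,b₁)` of `q₋₁..p₁`, global index) -/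
/-- Technical step `oddTab1_deg`. [folklore] -/






theorem oddTab1_deg : ∀ ek ∈ oddTab1, (∑ i, ek.1 i) = 1 := by decide
/-- Technical step `oddTab2_deg`. [folklore] -/
theorem oddTab2_deg : ∀ ek ∈ oddTab2, (∑ i, ek.1 i) = 2 := by decide
/-- Technical step `oddTab3_deg`. [folklore] -/
theorem oddTab3_deg : ∀ ek ∈ oddTab3, (∑ i, ek.1 i) = 3 := by decide
/-- Technical step `oddTab4_deg`. [folklore] -/
theorem oddTab4_deg : ∀ ek ∈ oddTab4, (∑ i, ek.1 i) = 4 := by decide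

/-! ## Part C: the local conservation law on flat polynomial densities -/








/-- Outside the window the summand vanishes. [folklore] -/
theorem consTerm_eq_zero (P : OscillatorChain) (g : (Fin 3 → ℝ × ℝ) → ℝ) (σ : Config) {x : ℤ}
    (hx : x ≠ -1 ∧ x ≠ 0 ∧ x ≠ 1) : consTerm P g σ x = 0 := by
  have hne : ∀ i : Fin 3, ((i : ℤ) - 1) ≠ x := by
    intro i; have := i.isLt; omega
  unfold consTerm
  simp [Function.update_of_ne, hne]

/-- The `tsum` of the route statement is the finite window sum. [folklore] -/
theorem tsum_consTerm (P : OscillatorChain) (g : (Fin 3 → ℝ × ℝ) → ℝ) (σ : Config) :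
    ∑' x, consTerm P g σ x = ∑ k : Fin 3, consTerm P g σ ((k : ℤ) - (1 : ℕ)) := by
  rw [tsum_eq_sum (s := ({-1, 0, 1} : Finset ℤ))]
  · rw [Fin.sum_univ_three]
    simp [Finset.sum_insert, Finset.sum_singleton, add_assoc]
  · intro x hx
    simp only [Finset.mem_insert, Finset.mem_singleton, not_or] at hx
    exact consTerm_eq_zero P g σ hx
/-- Technical step `flat3_update_q`. [folklore] -/

theorem flat3_update_q (σ : Config) (k : Fin 3) (t : ℝ) :
    flat3 (fun i : Fin 3 => Function.update σ ((k : ℤ) - (1 : ℕ)) (t, (σ ((k : ℤ) - (1 : ℕ))).2)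
      ((i : ℤ) - (1 : ℕ))) = Function.update (flat3 (win σ)) (qslot k) t := by
  funext j
  fin_cases k <;> fin_cases j <;> simp [flat3, win, qslot]
/-- Technical step `flat3_update_p`. [folklore] -/

theorem flat3_update_p (σ : Config) (k : Fin 3) (t : ℝ) :
    flat3 (fun i : Fin 3 => Function.update σ ((k : ℤ) - (1 : ℕ)) ((σ ((k : ℤ) - (1 : ℕ))).1, t)
      ((i : ℤ) - (1 : ℕ))) = Function.update (flat3 (win σ)) (pslot k) t := by
  funext j
  fin_cases k <;> fin_cases j <;> simp [flat3, win, pslot]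
/-- Technical step `flat3_win_q`. [folklore] -/

theorem flat3_win_q (σ : Config) (k : Fin 3) : flat3 (win σ) (qslot k) = (σ ((k : ℤ) - (1 : ℕ))).1 := by
  fin_cases k <;> simp [flat3, win, qslot]
/-- Technical step `flat3_win_p`. [folklore] -/

theorem flat3_win_p (σ : Config) (k : Fin 3) : flat3 (win σ) (pslot k) = (σ ((k : ℤ) - (1 : ℕ))).2 := by
  fin_cases k <;> simp [flat3, win, pslot]

/-- The conservation summand on a flat list-polynomial density. [folklore] -/
theorem consTerm_evalList (P : OscillatorChain) {κ : Type*} (L : List ((Fin 6 → ℕ) × κ)) (c : κ → ℝ)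
    (σ : Config) (k : Fin 3) :
    consTerm P (fun y => evalList L c (flat3 y)) σ ((k : ℤ) - (1 : ℕ)) =
      (σ ((k : ℤ) - (1 : ℕ))).2 * devalList (qslot k) L c (flat3 (win σ)) +
        (-deriv P.U (σ ((k : ℤ) - (1 : ℕ))).1 +
          (deriv P.V ((σ ((k : ℤ) - (1 : ℕ) + 1)).1 - (σ ((k : ℤ) - (1 : ℕ))).1) -
            deriv P.V ((σ ((k : ℤ) - (1 : ℕ))).1 - (σ ((k : ℤ) - (1 : ℕ) - 1)).1))) *
          devalList (pslot k) L c (flat3 (win σ)) := by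
  unfold consTerm
  simp only [flat3_update_q, flat3_update_p]
  rw [← flat3_win_q σ k, deriv_evalList, ← flat3_win_p σ k, deriv_evalList, flat3_win_q, flat3_win_p]
/-- Technical step `pinnedChain_force_split`. [folklore] -/



theorem pinnedChain_force_split (ω₂ lam β γ : ℝ) (σ : Config) (x : ℤ) :
    (-deriv (pinnedChain ω₂ lam β γ).U (σ x).1 +
        (deriv (pinnedChain ω₂ lam β γ).V ((σ (x + 1)).1 - (σ x).1) -
          deriv (pinnedChain ω₂ lam β γ).V ((σ x).1 - (σ (x - 1)).1))) =
      forceH ω₂ σ x + forceA lam β σ x := by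
  simp only [pinnedChain_deriv_U, pinnedChain_deriv_V, forceH, forceA]
  ring



/-- The window sum of the conservation law splits into the graded pieces. [folklore] -/
theorem sum_consTerm_pinnedChain (ω₂ lam β γ : ℝ) (c : ℕ → ℝ) (σ : Config) :
    ∑ k : Fin 3, consTerm (pinnedChain ω₂ lam β γ) (fun y => evalList oddTab c (flat3 y)) σ ((k : ℤ) - (1 : ℕ)) =
      (pieceH ω₂ oddTab1 c σ + pieceH ω₂ oddTab2 c σ + pieceH ω₂ oddTab3 c σ + pieceH ω₂ oddTab4 c σ) +
        (pieceA lam β oddTab1 c σ + pieceA lam β oddTab2 c σ + pieceA lam β oddTab3 c σ +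
          pieceA lam β oddTab4 c σ) := by
  simp only [consTerm_evalList, pinnedChain_force_split, pieceH, pieceA, oddTab, devalList_append,
    ← Finset.sum_add_distrib]
  refine Finset.sum_congr rfl fun k _ => ?_
  ring

/-! ## Part C2: translation sums, telescoping, homogeneity, graded identities -/


/-- **ψ-free form of the conservation law.** Summing the law over all windows meeting the support of a
finitely supported configuration, the flux terms telescope away. [folklore] -/
theorem sum_shifts_consTerm_eq_zero (P : OscillatorChain) (g : (Fin 3 → ℝ × ℝ) → ℝ)
    (ψ : (Fin 5 → ℝ × ℝ) → ℝ)
    (hcons : ∀ σ : Config, ∑ k : Fin 3, consTerm P g σ ((k : ℤ) - (1 : ℕ)) =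
      ψ (fun i : Fin 5 => σ ((i : ℤ) - (2 : ℕ))) - ψ (fun i : Fin 5 => σ ((i : ℤ) - (2 : ℕ) + 1)))
    (σ : Config) (hσ : ∀ y : ℤ, y < 0 ∨ 4 < y → σ y = 0) :
    ∑ m ∈ shifts, ∑ k : Fin 3, consTerm P g (shiftBy m σ) ((k : ℤ) - (1 : ℕ)) = 0 := by
  set S : ℤ → ℝ := fun m => ψ (fun i : Fin 5 => σ ((i : ℤ) - (2 : ℕ) + m)) with hS
  have h1 : ∀ m : ℤ, ∑ k : Fin 3, consTerm P g (shiftBy m σ) ((k : ℤ) - (1 : ℕ)) = S m - S (m + 1) := by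
    intro m
    rw [hcons]
    simp only [hS, shiftBy]
    congr 2
    funext i
    congr 1
    ring
  have hzero : ∀ m : ℤ, (m ≤ -3 ∨ 7 ≤ m) → S m = ψ (fun _ => 0) := by
    intro m hm
    simp only [hS]
    congr 1
    funext i
    have := i.isLt
    apply hσ
    omega
  simp only [h1, shifts]
  rw [Finset.sum_insert (by decide), Finset.sum_insert (by decide), Finset.sum_insert (by decide),
    Finset.sum_insert (by decide), Finset.sum_insert (by decide), Finset.sum_insert (by decide),
    Finset.sum_insert (by decide), Finset.sum_insert (by decide), Finset.sum_insert (by decide),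
    Finset.sum_singleton]
  have e1 : S (-3) = ψ (fun _ => 0) := hzero (-3) (by norm_num)
  have e2 : S (6 + 1) = ψ (fun _ => 0) := hzero (6 + 1) (by norm_num)
  norm_num at e1 e2 ⊢
  linarith
/-- Technical step `flat3_win_scale`. [folklore] -/



theorem flat3_win_scale (s : ℝ) (σ : Config) : flat3 (win (scale s σ)) = fun i => s * flat3 (win σ) i := by
  funext j
  fin_cases j <;> simp [flat3, win, scale]
/-- Technical step `shiftBy_scale`. [folklore] -/

theorem shiftBy_scale (m : ℤ) (s : ℝ) (σ : Config) : shiftBy m (scale s σ) = scale s (shiftBy m σ) := rfl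
/-- Technical step `pieceH_scale`. [folklore] -/

theorem pieceH_scale (ω₂ : ℝ) (T : List ((Fin 6 → ℕ) × ℕ)) (c : ℕ → ℝ) {d : ℕ}
    (hT : ∀ ek ∈ T, (∑ i, ek.1 i) = d) (hd : 1 ≤ d) (s : ℝ) (σ : Config) :
    pieceH ω₂ T c (scale s σ) = s ^ d * pieceH ω₂ T c σ := by
  have hpow : s ^ d = s * s ^ (d - 1) := by
    rw [← pow_succ']; congr 1; omega
  unfold pieceH
  rw [flat3_win_scale, Finset.mul_sum]
  refine Finset.sum_congr rfl fun k _ => ?_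
  rw [devalList_smul _ _ _ hT, devalList_smul _ _ _ hT, hpow]
  simp only [scale, forceH]
  ring
/-- Technical step `pieceA_scale`. [folklore] -/

theorem pieceA_scale (lam β : ℝ) (T : List ((Fin 6 → ℕ) × ℕ)) (c : ℕ → ℝ) {d : ℕ}
    (hT : ∀ ek ∈ T, (∑ i, ek.1 i) = d) (hd : 1 ≤ d) (s : ℝ) (σ : Config) :
    pieceA lam β T c (scale s σ) = s ^ (d + 2) * pieceA lam β T c σ := by
  have hpow : s ^ (d + 2) = s ^ 3 * s ^ (d - 1) := by
    rw [← pow_add]; congr 1; omega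
  unfold pieceA
  rw [flat3_win_scale, Finset.mul_sum]
  refine Finset.sum_congr rfl fun k _ => ?_
  rw [devalList_smul _ _ _ hT, hpow]
  simp only [scale, forceA]
  ring
/-- Technical step `scale_supp`. [folklore] -/

theorem scale_supp {σ : Config} (hσ : ∀ y : ℤ, y < 0 ∨ 4 < y → σ y = 0) (s : ℝ) :
    ∀ y : ℤ, y < 0 ∨ 4 < y → scale s σ y = 0 := by
  intro y hy
  simp [scale, hσ y hy]

/-- **Graded identities.** For a momentum-odd table density `g = ∑ c_k m_k` with the local conservation
law, and a configuration supported on sites `0..4`, the degree-1..4 components of the translation-summed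
Liouville derivative vanish separately. [folklore] -/
theorem graded_zero (ω₂ lam β γ : ℝ) (c : ℕ → ℝ) (ψ : (Fin 5 → ℝ × ℝ) → ℝ)
    (hcons : ∀ σ : Config, ∑ k : Fin 3, consTerm (pinnedChain ω₂ lam β γ)
      (fun y => evalList oddTab c (flat3 y)) σ ((k : ℤ) - (1 : ℕ)) =
      ψ (fun i : Fin 5 => σ ((i : ℤ) - (2 : ℕ))) - ψ (fun i : Fin 5 => σ ((i : ℤ) - (2 : ℕ) + 1)))
    (σ : Config) (hσ : ∀ y : ℤ, y < 0 ∨ 4 < y → σ y = 0) :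
    lamH ω₂ oddTab1 c σ = 0 ∧ lamH ω₂ oddTab2 c σ = 0 ∧
      lamH ω₂ oddTab3 c σ + lamA lam β oddTab1 c σ = 0 ∧
      lamH ω₂ oddTab4 c σ + lamA lam β oddTab2 c σ = 0 := by
  have key : ∀ s : ℝ,
      s ^ 1 * lamH ω₂ oddTab1 c σ + s ^ 2 * lamH ω₂ oddTab2 c σ + s ^ 3 * lamH ω₂ oddTab3 c σ +
        s ^ 4 * lamH ω₂ oddTab4 c σ + (s ^ (1 + 2) * lamA lam β oddTab1 c σ +
        s ^ (2 + 2) * lamA lam β oddTab2 c σ + s ^ (3 + 2) * lamA lam β oddTab3 c σ +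
        s ^ (4 + 2) * lamA lam β oddTab4 c σ) = 0 := by
    intro s
    have h := sum_shifts_consTerm_eq_zero (pinnedChain ω₂ lam β γ) _ ψ hcons (scale s σ) (scale_supp hσ s)
    simp only [sum_consTerm_pinnedChain, shiftBy_scale,
      pieceH_scale ω₂ oddTab1 c oddTab1_deg le_rfl, pieceH_scale ω₂ oddTab2 c oddTab2_deg (by norm_num),
      pieceH_scale ω₂ oddTab3 c oddTab3_deg (by norm_num), pieceH_scale ω₂ oddTab4 c oddTab4_deg (by norm_num),
      pieceA_scale lam β oddTab1 c oddTab1_deg le_rfl, pieceA_scale lam β oddTab2 c oddTab2_deg (by norm_num),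
      pieceA_scale lam β oddTab3 c oddTab3_deg (by norm_num), pieceA_scale lam β oddTab4 c oddTab4_deg (by norm_num),
      Finset.sum_add_distrib, ← Finset.mul_sum] at h
    simpa [lamH, lamA] using h
  have e1 := key 1; have e2 := key 2; have e3 := key 3; have e4 := key 4; have e5 := key 5; have e6 := key 6
  norm_num at e1 e2 e3 e4 e5 e6
  refine ⟨?_, ?_, ?_, ?_⟩
  · linear_combination (6 : ℝ) * e1 + (-15 / 2 : ℝ) * e2 + (20 / 3 : ℝ) * e3 + (-15 / 4 : ℝ) * e4 +
      (6 / 5 : ℝ) * e5 + (-1 / 6 : ℝ) * e6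
  · linear_combination (-87 / 10 : ℝ) * e1 + (117 / 8 : ℝ) * e2 + (-127 / 9 : ℝ) * e3 + (33 / 4 : ℝ) * e4 +
      (-27 / 10 : ℝ) * e5 + (137 / 360 : ℝ) * e6
  · linear_combination (29 / 6 : ℝ) * e1 + (-461 / 48 : ℝ) * e2 + (31 / 3 : ℝ) * e3 + (-307 / 48 : ℝ) * e4 +
      (13 / 6 : ℝ) * e5 + (-5 / 16 : ℝ) * e6
  · linear_combination (-31 / 24 : ℝ) * e1 + (137 / 48 : ℝ) * e2 + (-121 / 36 : ℝ) * e3 + (107 / 48 : ℝ) * e4 +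
      (-19 / 24 : ℝ) * e5 + (17 / 144 : ℝ) * e6

end Summit.AtomisticToContinuum.FouriersLaw.Theorems.NoOddCharge

end
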